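import Summits.QuantumFields.YangMills.Theorems.BalabanUVNodesN12DirectSurjHsurj

/-!
# DAG node N12 [B15] — (P4)′ road: the right-inverse letter from ONE `Z`-wide plaquette letter (`M₁ ≥ 2`)

Cell `pub-ymgap` (HUMAN RULINGS D-0062 ∕ D-0149), width seat `pub-ymgap-dag-n12-w6` g6 (director-ym R463-ym; target = dag-n12-c's (P4)′ socket of record, INBOX l.42120).  Key K1⁹
`stmt-QuantumFields-27364`, `--kind proof --supports … --as helper`; count-neutral; THEOREMS ONLY (0 `def`, 0 `sorry`).

CONTENTS.  ★★★ `exists_rightInverse_letter_of_plaqSmallOn` — `…N12DirectSurjHsurj.exists_rightInverse_letter` with the box letter replaced by `PlaqSmallOn {p : all four corners in Z} ε U₀`: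
the boxes of half-width `L^j + (L^j−1)∕2` around inner `j`-sites lie in `Ω_{j−1}(Z) ⊆ Z` for `M₁ ≥ 2` (`…HsurjPrelim.cover_mem_of_near_inner`, [III] (2.13) collar).  This is the
form the record's small-field condition on `Z` supplies ([III] (1.4)).

HONEST FRAMING.  Bookkeeping by name; per-height ∕ per-instance EXISTENCE constants (print's (46)∕(83) are explicit and volume-uniform — NOT claimed); nothing of
Bałaban's asserted; N12 NOT discharged; K1⁹ NOT closed; count-neutral (typed 28∕28 · discharged 5∕27 unmoved); R4 closes only the conditional finite-`𝕋⁴` rung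
`BalabanLadder.UV`; the YM mass gap (Clay) is NOT proved by any of this.
-/

noncomputable section

open scoped BigOperators

namespace Summit.QuantumFields.YangMills.BalabanUVNodes.N12DirectSurjHsurjZ

open Literature.MathematicalPhysics.QuantumFieldTheory.Balaban1983to89
open T4Continuum (T4Family)
open T4AdjointCovarianceUnitary (lieSU)
open B15DeterminingSets
open B14.Eq213DetSet (Bj maxDomT)
open B14.Eq213MaximalDomains (side)
open B15Eq112TorusCover (lift cover)
open Node00
open Summit.QuantumFields.YangMills.BalabanUVNodes.N12DirectSurjHsurjPrelim (cover_mem_of_near_inner)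
open Summit.QuantumFields.YangMills.BalabanUVNodes.N12DirectSurjHsurj (exists_rightInverse_letter)

section ZLetter

variable {F : T4Family} {N : ℕ} [NeZero N] {K k : ℕ}

/-- ★★★ **(P4)′ FROM A `Z`-WIDE PLAQUETTE LETTER** (`M₁ ≥ 2`): as `exists_rightInverse_letter`, with the box letter replaced by `PlaqSmallOn {p : all four corners in Z} ε U₀` — the boxes around
inner `j`-sites lie in `Ω_{j−1}(Z) ⊆ Z` (`cover_mem_of_near_inner`).  This is the form the record's small-field condition on `Z` supplies. [cite: Balaban1988Convergent, (1.4) p.247, (2.13)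
pp.256-257; Balaban1985Variational, (83) p.290] -/
theorem exists_rightInverse_letter_of_plaqSmallOn (hkK : k + 1 ≤ (F.P K).m + (F.P K).K) :
    ∃ ε : ℝ, 0 < ε ∧ ∀ (M₁ : ℕ) (_ : 2 ≤ M₁) (Z : Set (Site (F.P K) 0)) (_ : side (F.P K).L M₁ k ∣ (F.P K).sitesPerDir 0),
      ∃ B : ℝ, 0 ≤ B ∧ ∀ (W : MSField (F.P K) (SU N)) (U₀ : GaugeField (F.P K) 0 (SU N)),
        AgreeOn (Bj M₁ Z k) (avgFamily (avOfRecord F N K) U₀) W → SmallBelow (avOfRecord F N K) k U₀ →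
        PlaqSmallOn {p : Plaq (F.P K) 0 | p.src ∈ Z ∧ p.src.shift p.μ ∈ Z ∧ p.src.shift p.ν ∈ Z ∧ (p.src.shift p.μ).shift p.ν ∈ Z} ε U₀ →
        ∃ H : (Fin (constrCard (Bj M₁ Z k) k) → lieSU (Fin N)) → PBond (F.P K) 0 → lieSU (Fin N),
          (∀ v, fderiv ℝ (msChart F N K k (Bj M₁ Z k) W U₀) 0 (H v) = v) ∧
          ∀ v, Real.sqrt (∑ b, ‖H v b‖ ^ 2) ≤ B * ‖v‖ := by
  obtain ⟨ε, hε, h⟩ := exists_rightInverse_letter (F := F) (N := N) (K := K) (k := k) hkK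
  refine ⟨ε, hε, fun M₁ hM2 Z hdiv => ?_⟩
  obtain ⟨B, hB, hH⟩ := h M₁ (le_trans one_le_two hM2) Z hdiv
  refine ⟨B, hB, fun W U₀ hU hsb hZ => hH W U₀ hU hsb fun j hj1 hjk y hy => ?_⟩
  rintro p ⟨z, hlo, hhi, hsrc⟩
  have he : ∀ (μ κ : Fin (F.P K).d), 0 ≤ B7Prop1Explicit.e μ κ ∧ B7Prop1Explicit.e μ κ ≤ 1 := fun μ κ => by
    rw [B7Prop1Explicit.e_apply]; split_ifs <;> simp
  have hnear : ∀ w : Fin (F.P K).d → ℤ, z ≤ w → w ≤ z + B7Prop1Explicit.e p.μ + B7Prop1Explicit.e p.ν →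
      ∀ κ, |w κ - lift (F.P K) (embIter j y) κ| ≤ (((F.P K).L ^ j : ℕ) : ℤ) + ((((F.P K).L ^ j - 1) / 2 : ℕ) : ℤ) := by
    intro w h1 h2 κ
    have a := hlo κ; have b := hhi κ; have c := h1 κ; have d := h2 κ
    simp only [Pi.add_apply] at a b c d
    rw [abs_le]; constructor <;> linarith
  have hz0 : z ≤ z + B7Prop1Explicit.e p.μ + B7Prop1Explicit.e p.ν := fun κ => by
    simp only [Pi.add_apply]; linarith [(he p.μ κ).1, (he p.ν κ).1]
  have hmem : ∀ w : Fin (F.P K).d → ℤ, z ≤ w → w ≤ z + B7Prop1Explicit.e p.μ + B7Prop1Explicit.e p.ν → cover (F.P K) w ∈ Z :=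
    fun w h1 h2 => cover_mem_of_near_inner hM2 hdiv hj1 hjk hy w (hnear w h1 h2)
  have c1 : p.src = cover (F.P K) z := by rw [hsrc]; rfl
  have c2 : p.src.shift p.μ = cover (F.P K) (z + B7Prop1Explicit.e p.μ) := by
    rw [hsrc, ← T4AxialGaugeSmallField.castSite_add_e]; rfl
  have c3 : p.src.shift p.ν = cover (F.P K) (z + B7Prop1Explicit.e p.ν) := by
    rw [hsrc, ← T4AxialGaugeSmallField.castSite_add_e]; rfl
  have c4 : (p.src.shift p.μ).shift p.ν = cover (F.P K) (z + B7Prop1Explicit.e p.μ + B7Prop1Explicit.e p.ν) := by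
    rw [hsrc, ← T4AxialGaugeSmallField.castSite_add_e, ← T4AxialGaugeSmallField.castSite_add_e]; rfl
  refine hZ p ⟨?_, ?_, ?_, ?_⟩
  · rw [c1]; exact hmem z (le_refl _) hz0
  · rw [c2]
    exact hmem _ (fun κ => by simp only [Pi.add_apply]; linarith [(he p.μ κ).1])
      (fun κ => by simp only [Pi.add_apply]; linarith [(he p.ν κ).1])
  · rw [c3]
    exact hmem _ (fun κ => by simp only [Pi.add_apply]; linarith [(he p.ν κ).1])
      (fun κ => by simp only [Pi.add_apply]; linarith [(he p.μ κ).1])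
  · rw [c4]; exact hmem _ hz0 (le_refl _)

end ZLetter

end Summit.QuantumFields.YangMills.BalabanUVNodes.N12DirectSurjHsurjZ

end
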